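import Literature.NumberTheory.Automorphic.EichlerEmbeddingLocalRamified
import Mathlib.NumberTheory.Padics.RingHoms
import Mathlib.GroupTheory.Index
import HarnessLib

/-!
# The local unit index `[ℤ_(p)[σ]ˣ : ℤ_(p)[pσ]ˣ] = p + 1 - #{x mod p : x² + tx + n ≡ 0}`
# of two consecutive quadratic orders (Cox Thm. 7.24, proof; Vignéras III §5 Cor. 5.12)

Topic `NumberTheory/Automorphic`; definitions with bodies and theorems (no named fact, no
`sorry`). Seventh brick of the Brandt-module side of the Eichler–Pizer trace identity: the local
factors of the idelic index formula `QuadraticOrderClassNumberIndex.classNumber_mul_relIndex_eq`.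

For orders `B = ℤ[pσ] ⊆ B' = ℤ[σ]` of the quadratic algebra `ℚ(γ)` inside a division quaternion
algebra `D` (`σ = r₀ + γ/m`, `σ² = tσ - n`) and a prime `p`:

* `StepHyp.relIndex_eq` — `[B'_(p)ˣ : B_(p)ˣ] = p + 1 - ρ`, `ρ = #{k mod p : p ∣ k² + tk + n}`,
  where `B_(p)ˣ = stabCentralizer B_(p) γ` (units of `ℚ(γ)` stabilising the localised order).

So `[B'_(p)ˣ : B_(p)ˣ]` is `p - (d/p)` when `B'` is maximal at `p` (`ρ = 1 + (d/p)`) and `p`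
otherwise (`ρ = 1`): iterating along `ℤ[σ] ⊃ ℤ[pσ] ⊃ ℤ[p²σ] ⊃ ⋯` gives Dedekind's
`[𝒪_{K,p}ˣ : 𝒪_{f,p}ˣ] = p^{e-1}(p - (d_K/p))`.

## Proof

Reduction modulo `p`: `u = x + yσ ∈ B'_(p)ˣ ↦ x̄ + ȳω̄ ∈ (𝔽_p[X]/(X² - tX + n))ˣ` is a surjective
homomorphism (`Psi`, `Psi_surjective`: lift, and `1 + pℤ_p[σ] ⊆ ℤ_p[σ]ˣ`) whose kernel modulo the
scalars `𝔽_pˣ` is `B_(p)ˣ` (`comap_scalarUnits_Psi`); and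
`#(𝔽_p[X]/(X² - tX + n))ˣ = (p - 1)(p + 1 - ρ)` by counting the pairs `(x, y)` with
`x² + txy + ny² ≠ 0` (`card_units_quadAlg`).

## References

* D. A. Cox, *Primes of the form x² + ny²*, 2nd ed. (2013), Thm. 7.24 and its proof, (7.27)
  [Cox2013].
* M.-F. Vignéras, *Arithmétique des algèbres de quaternions*, LNM 800 (1980), Ch. III §5
  Cor. 5.12 [VignerasLNM800].
-/

noncomputable section

open scoped Pointwise

universe u

namespace Literature.NumberTheory.Automorphic

namespace Brandt

open Literature.NumberTheory.QuadraticFields.PadicQuadratic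
open scoped QuadraticAlgebra

/-! ### Reduction modulo `p` of `p`-adic integers -/

section Red

variable {p : ℕ} [hp : Fact p.Prime]

/-- Reduction modulo `p` of a `p`-adic number (`0` on non-integral elements). [folklore] -/
def red (p : ℕ) [Fact p.Prime] (x : ℚ_[p]) : ZMod p :=
  if h : ‖x‖ ≤ 1 then PadicInt.toZMod ⟨x, h⟩ else 0

/-- `red` on an integral element. [folklore] -/
theorem red_of_le {x : ℚ_[p]} (h : ‖x‖ ≤ 1) : red p x = PadicInt.toZMod ⟨x, h⟩ := dif_pos h

/-- `red` is additive on integral elements. [folklore] -/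
theorem red_add {x y : ℚ_[p]} (hx : ‖x‖ ≤ 1) (hy : ‖y‖ ≤ 1) : red p (x + y) = red p x + red p y := by
  have hxy : ‖x + y‖ ≤ 1 := (Padic.nonarchimedean _ _).trans (max_le hx hy)
  rw [red_of_le hx, red_of_le hy, red_of_le hxy, ← map_add]
  rfl

/-- `red` is multiplicative on integral elements. [folklore] -/
theorem red_mul {x y : ℚ_[p]} (hx : ‖x‖ ≤ 1) (hy : ‖y‖ ≤ 1) : red p (x * y) = red p x * red p y := by
  have hxy : ‖x * y‖ ≤ 1 := by rw [norm_mul]; exact mul_le_one₀ hx (norm_nonneg _) hy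
  rw [red_of_le hx, red_of_le hy, red_of_le hxy, ← map_mul]
  rfl

/-- `red 1 = 1`. [folklore] -/
theorem red_one : red p (1 : ℚ_[p]) = 1 := by
  rw [red_of_le (by rw [norm_one]), ← map_one PadicInt.toZMod]; rfl

/-- `red 0 = 0`. [folklore] -/
theorem red_zero : red p (0 : ℚ_[p]) = 0 := by
  rw [red_of_le (by rw [norm_zero]; exact zero_le_one), ← map_zero PadicInt.toZMod]; rfl

/-- `red` of an integer. [folklore] -/
theorem red_intCast (k : ℤ) : red p (k : ℚ_[p]) = (k : ZMod p) := by
  rw [red_of_le (Padic.norm_int_le_one k), ← map_intCast PadicInt.toZMod k]; rfl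

/-- `red` of a natural number. [folklore] -/
theorem red_natCast (k : ℕ) : red p (k : ℚ_[p]) = (k : ZMod p) := by
  rw [← Int.cast_natCast, red_intCast]; simp

/-- **`red x = 0 ↔ ‖x‖ < 1`** for an integral `x`. [folklore] -/
theorem red_eq_zero_iff {x : ℚ_[p]} (hx : ‖x‖ ≤ 1) : red p x = 0 ↔ ‖x‖ < 1 := by
  rw [red_of_le hx, ← RingHom.mem_ker, PadicInt.ker_toZMod, IsLocalRing.mem_maximalIdeal,
    PadicInt.mem_nonunits]
  rfl

/-- `red` commutes with negation on integral elements. [folklore] -/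
theorem red_neg {x : ℚ_[p]} (hx : ‖x‖ ≤ 1) : red p (-x) = -red p x := by
  have hnx : ‖-x‖ ≤ 1 := by rwa [norm_neg]
  rw [red_of_le hx, red_of_le hnx, ← map_neg]
  rfl

/-- `red` is compatible with subtraction on integral elements. [folklore] -/
theorem red_sub {x y : ℚ_[p]} (hx : ‖x‖ ≤ 1) (hy : ‖y‖ ≤ 1) : red p (x - y) = red p x - red p y := by
  rw [sub_eq_add_neg, red_add hx (by rwa [norm_neg]), red_neg hy, sub_eq_add_neg]

/-- `red x = red y ↔ ‖x - y‖ < 1` for integral `x, y`. [folklore] -/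
theorem red_eq_red_iff {x y : ℚ_[p]} (hx : ‖x‖ ≤ 1) (hy : ‖y‖ ≤ 1) : red p x = red p y ↔ ‖x - y‖ < 1 := by
  have hxy : ‖x - y‖ ≤ 1 := by
    rw [sub_eq_add_neg]; exact (Padic.nonarchimedean _ _).trans (max_le hx (by rwa [norm_neg]))
  rw [← sub_eq_zero, ← red_sub hx hy, red_eq_zero_iff hxy]

/-- `red` is surjective on integers: `red (val x) = x`. [folklore] -/
theorem red_natCast_val (x : ZMod p) : red p ((x.val : ℕ) : ℚ_[p]) = x := by
  rw [red_natCast, ZMod.natCast_zmod_val]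

end Red

/-! ### Coordinates along a generator and the reduction map to `𝔽_p[ω̄]` -/

section Theta

variable {q : ℕ} [hq : Fact q.Prime] {a b : ℚ_[q]}

/-- The `σ`-coordinate of `z` in the basis `(1, σ)`. [folklore] -/
def yCo (σ z : QuadraticAlgebra ℚ_[q] a b) : ℚ_[q] := z.im / σ.im

/-- The `1`-coordinate of `z` in the basis `(1, σ)`. [folklore] -/
def xCo (σ z : QuadraticAlgebra ℚ_[q] a b) : ℚ_[q] := z.re - yCo σ z * σ.re

/-- `z = xCo • 1 + yCo • σ`. [folklore] -/
theorem eq_xCo_add_yCo {σ : QuadraticAlgebra ℚ_[q] a b} (hσ : σ.im ≠ 0) (z : QuadraticAlgebra ℚ_[q] a b) :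
    z = xCo σ z • 1 + yCo σ z • σ := by
  ext
  · simp [xCo, QuadraticAlgebra.re_one]
  · simp [yCo, QuadraticAlgebra.im_one, div_mul_cancel₀ _ hσ]

/-- The coordinates of `x • 1 + y • σ` are `(x, y)`. [folklore] -/
theorem xCo_yCo_of_eq {σ : QuadraticAlgebra ℚ_[q] a b} (hσ : σ.im ≠ 0) {z : QuadraticAlgebra ℚ_[q] a b}
    {x y : ℚ_[q]} (h : z = x • 1 + y • σ) : xCo σ z = x ∧ yCo σ z = y := by
  have e := (eq_xCo_add_yCo hσ z).symm.trans h
  exact smul_one_add_smul_inj hσ e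

/-- Coordinates of an element of `[1, σ]` are integral. [folklore] -/
theorem norm_xCo_le_of_mem {σ z : QuadraticAlgebra ℚ_[q] a b} (hσ : σ.im ≠ 0) (hz : z ∈ latt 1 σ) :
    ‖xCo σ z‖ ≤ 1 ∧ ‖yCo σ z‖ ≤ 1 := by
  obtain ⟨u, v, hu, hv, h⟩ := hz
  obtain ⟨h1, h2⟩ := xCo_yCo_of_eq hσ h
  exact ⟨h1 ▸ hu, h2 ▸ hv⟩

/-- An element with integral coordinates lies in `[1, σ]`. [folklore] -/
theorem mem_latt_of_norm_le {σ z : QuadraticAlgebra ℚ_[q] a b} (hσ : σ.im ≠ 0) (hx : ‖xCo σ z‖ ≤ 1)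
    (hy : ‖yCo σ z‖ ≤ 1) : z ∈ latt 1 σ :=
  ⟨_, _, hx, hy, eq_xCo_add_yCo hσ z⟩

/-- Coordinates of a product: `(x + yσ)(x' + y'σ) = (xx' + a' yy') + (xy' + x'y + b' yy')σ` where
`σ² = a' + b'σ`, `a' = -N σ`, `b' = tr σ`. [folklore] -/
theorem xCo_yCo_mul {σ : QuadraticAlgebra ℚ_[q] a b} (hσ : σ.im ≠ 0) (z w : QuadraticAlgebra ℚ_[q] a b) :
    xCo σ (z * w) = xCo σ z * xCo σ w + (-σ.norm) * (yCo σ z * yCo σ w) ∧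
      yCo σ (z * w) = xCo σ z * yCo σ w + xCo σ w * yCo σ z + tr σ * (yCo σ z * yCo σ w) := by
  apply xCo_yCo_of_eq hσ
  set x := xCo σ z
  set y := yCo σ z
  set x' := xCo σ w
  set y' := yCo σ w
  have hz := eq_xCo_add_yCo hσ z
  have hw := eq_xCo_add_yCo hσ w
  have hσσ : σ * σ = tr σ • σ - algebraMap _ _ σ.norm := mul_self_eq σ
  rw [Algebra.algebraMap_eq_smul_one] at hσσ
  calc z * w = (x • 1 + y • σ) * (x' • 1 + y' • σ) := by rw [← hz, ← hw]
    _ = (x * x') • 1 + (x * y' + x' * y) • σ + (y * y') • (σ * σ) := by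
        simp only [add_mul, mul_add, smul_mul_smul_comm, one_mul, mul_one, add_smul, mul_comm x' y]
        abel
    _ = _ := by rw [hσσ, smul_sub, smul_smul, smul_smul]; module

variable (q) in
/-- The residue algebra `𝔽_q[X]/(X² - t X + n)` attached to `σ` (`tr σ = t`, `N σ = n`). [folklore] -/
abbrev ResAlg (t n : ℤ) : Type := QuadraticAlgebra (ZMod q) (-(n : ZMod q)) (t : ZMod q)

/-- **The reduction map `Θ : [1, σ] → 𝔽_q[ω̄]`**, `x + yσ ↦ x̄ + ȳω̄`. [folklore] -/
def theta (σ : QuadraticAlgebra ℚ_[q] a b) (t n : ℤ) (z : QuadraticAlgebra ℚ_[q] a b) : ResAlg q t n :=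
  ⟨red q (xCo σ z), red q (yCo σ z)⟩

/-- `Θ 1 = 1`. [folklore] -/
theorem theta_one {σ : QuadraticAlgebra ℚ_[q] a b} (hσ : σ.im ≠ 0) (t n : ℤ) : theta σ t n 1 = 1 := by
  obtain ⟨h1, h2⟩ := xCo_yCo_of_eq hσ (show (1 : QuadraticAlgebra ℚ_[q] a b) = (1 : ℚ_[q]) • 1 + (0 : ℚ_[q]) • σ by
    rw [one_smul, zero_smul, add_zero])
  ext
  · simp [theta, h1, red_one, QuadraticAlgebra.re_one]
  · simp [theta, h2, red_zero, QuadraticAlgebra.im_one]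

/-- **`Θ` is multiplicative on `[1, σ]`** (when `tr σ = t`, `N σ = n`). [folklore] -/
theorem theta_mul {σ : QuadraticAlgebra ℚ_[q] a b} (hσ : σ.im ≠ 0) {t n : ℤ} (ht : tr σ = t)
    (hn : σ.norm = n) {z w : QuadraticAlgebra ℚ_[q] a b} (hz : z ∈ latt 1 σ) (hw : w ∈ latt 1 σ) :
    theta σ t n (z * w) = theta σ t n z * theta σ t n w := by
  obtain ⟨hxz, hyz⟩ := norm_xCo_le_of_mem hσ hz
  obtain ⟨hxw, hyw⟩ := norm_xCo_le_of_mem hσ hw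
  obtain ⟨h1, h2⟩ := xCo_yCo_mul hσ z w
  have hnn : ‖-σ.norm‖ ≤ 1 := by rw [norm_neg, hn]; exact Padic.norm_int_le_one _
  have htt : ‖tr σ‖ ≤ 1 := by rw [ht]; exact Padic.norm_int_le_one _
  have hm1 : ‖xCo σ z * xCo σ w‖ ≤ 1 := by rw [norm_mul]; exact mul_le_one₀ hxz (norm_nonneg _) hxw
  have hyy : ‖yCo σ z * yCo σ w‖ ≤ 1 := by rw [norm_mul]; exact mul_le_one₀ hyz (norm_nonneg _) hyw
  have hm2 : ‖-σ.norm * (yCo σ z * yCo σ w)‖ ≤ 1 := by rw [norm_mul]; exact mul_le_one₀ hnn (norm_nonneg _) hyy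
  have hm3 : ‖xCo σ z * yCo σ w‖ ≤ 1 := by rw [norm_mul]; exact mul_le_one₀ hxz (norm_nonneg _) hyw
  have hm4 : ‖xCo σ w * yCo σ z‖ ≤ 1 := by rw [norm_mul]; exact mul_le_one₀ hxw (norm_nonneg _) hyz
  have hm5 : ‖tr σ * (yCo σ z * yCo σ w)‖ ≤ 1 := by rw [norm_mul]; exact mul_le_one₀ htt (norm_nonneg _) hyy
  have hm34 : ‖xCo σ z * yCo σ w + xCo σ w * yCo σ z‖ ≤ 1 := (Padic.nonarchimedean _ _).trans (max_le hm3 hm4)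
  ext
  · simp only [theta, QuadraticAlgebra.re_mul]
    rw [h1, red_add hm1 hm2, red_mul hxz hxw, red_mul hnn hyy, red_mul hyz hyw,
      show red q (-σ.norm) = -(n : ZMod q) by rw [hn, ← Int.cast_neg, red_intCast]; simp]
    ring
  · simp only [theta, QuadraticAlgebra.im_mul]
    rw [h2, red_add hm34 hm5, red_add hm3 hm4, red_mul hxz hyw, red_mul hxw hyz, red_mul htt hyy,
      red_mul hyz hyw, ht, red_intCast]
    ring

/-- `Θ z` is a scalar iff the `σ`-coordinate of `z` lies in `qℤ_q`. [folklore] -/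
theorem theta_im_eq_zero_iff {σ : QuadraticAlgebra ℚ_[q] a b} (hσ : σ.im ≠ 0) {t n : ℤ}
    {z : QuadraticAlgebra ℚ_[q] a b} (hz : z ∈ latt 1 σ) : (theta σ t n z).im = 0 ↔ ‖yCo σ z‖ < 1 := by
  change red q (yCo σ z) = 0 ↔ _
  exact red_eq_zero_iff (norm_xCo_le_of_mem hσ hz).2

/-- **Lifting along `Θ`**: `Θ z = Θ z'` iff `z - z' ∈ q[1, σ]`. [folklore] -/
theorem theta_eq_theta_iff {σ : QuadraticAlgebra ℚ_[q] a b} (hσ : σ.im ≠ 0) {t n : ℤ}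
    {z z' : QuadraticAlgebra ℚ_[q] a b} (hz : z ∈ latt 1 σ) (hz' : z' ∈ latt 1 σ) :
    theta σ t n z = theta σ t n z' ↔ ∃ w ∈ latt 1 σ, z - z' = (q : ℚ_[q]) • w := by
  obtain ⟨hxz, hyz⟩ := norm_xCo_le_of_mem hσ hz
  obtain ⟨hxz', hyz'⟩ := norm_xCo_le_of_mem hσ hz'
  have hsub : z - z' = (xCo σ z - xCo σ z') • 1 + (yCo σ z - yCo σ z') • σ := by
    conv_lhs => rw [eq_xCo_add_yCo hσ z, eq_xCo_add_yCo hσ z']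
    simp only [sub_smul]; abel
  constructor
  · intro h
    have h1 : red q (xCo σ z) = red q (xCo σ z') := congrArg QuadraticAlgebra.re h
    have h2 : red q (yCo σ z) = red q (yCo σ z') := congrArg QuadraticAlgebra.im h
    rw [red_eq_red_iff hxz hxz', norm_lt_one_iff_exists] at h1
    rw [red_eq_red_iff hyz hyz', norm_lt_one_iff_exists] at h2
    obtain ⟨c₁, hc₁, e₁⟩ := h1
    obtain ⟨c₂, hc₂, e₂⟩ := h2
    refine ⟨c₁ • 1 + c₂ • σ, ⟨c₁, c₂, hc₁, hc₂, rfl⟩, ?_⟩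
    rw [hsub, e₁, e₂, smul_add, smul_smul, smul_smul]
  · rintro ⟨w, hw, hzw⟩
    obtain ⟨hxw, hyw⟩ := norm_xCo_le_of_mem hσ hw
    have hq1 : ‖(q : ℚ_[q])‖ < 1 := Padic.norm_p_lt_one
    have hw' : (q : ℚ_[q]) • w = ((q : ℚ_[q]) * xCo σ w) • 1 + ((q : ℚ_[q]) * yCo σ w) • σ := by
      conv_lhs => rw [eq_xCo_add_yCo hσ w]
      rw [smul_add, smul_smul, smul_smul]
    obtain ⟨e1', e2'⟩ := smul_one_add_smul_inj hσ (hsub.symm.trans (hzw.trans hw'))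
    ext
    · change red q (xCo σ z) = red q (xCo σ z')
      rw [red_eq_red_iff hxz hxz', e1', norm_mul]
      exact mul_lt_one_of_nonneg_of_lt_one_left (norm_nonneg _) hq1 hxw
    · change red q (yCo σ z) = red q (yCo σ z')
      rw [red_eq_red_iff hyz hyz', e2', norm_mul]
      exact mul_lt_one_of_nonneg_of_lt_one_left (norm_nonneg _) hq1 hyw

end Theta

/-! ### Counting the units of `𝔽_q[X]/(X² - tX + n)` -/

section Count

variable {q : ℕ} [hq : Fact q.Prime]

/-- `Mˣ ≃ {x : M // IsUnit x}`. [folklore] -/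
def unitsEquivIsUnitSubtype (M : Type*) [Monoid M] : Mˣ ≃ {x : M // IsUnit x} where
  toFun u := ⟨u, u.isUnit⟩
  invFun x := x.2.unit
  left_inv u := Units.ext (IsUnit.unit_spec u.isUnit)
  right_inv x := Subtype.ext (IsUnit.unit_spec x.2)

/-- `𝔽_q[ω̄]` is finite. [folklore] -/
instance instFiniteResAlg (t n : ℤ) : Finite (ResAlg q t n) :=
  Finite.of_equiv _ (QuadraticAlgebra.equivProd _ _).symm

/-- The norm form of `𝔽_q[ω̄]` in coordinates: `N(x + yω̄) = x² + txy + ny²`. [folklore] -/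
theorem norm_resAlg (t n : ℤ) (z : ResAlg q t n) :
    z.norm = z.re ^ 2 + (t : ZMod q) * z.re * z.im + (n : ZMod q) * z.im ^ 2 := by
  rw [QuadraticAlgebra.norm_def]; ring

/-- The number of roots of `X² + tX + n` modulo `q`, read in `ZMod q`. [folklore] -/
theorem card_roots_zmod (t n : ℤ) :
    ((Finset.univ : Finset (ZMod q)).filter (fun k => k ^ 2 + (t : ZMod q) * k + (n : ZMod q) = 0)).card =
      ((Finset.range q).filter (fun k : ℕ => (q : ℤ) ∣ (k : ℤ) ^ 2 + t * k + n)).card := by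
  symm
  refine Finset.card_bij (fun k _ => (k : ZMod q)) (fun k hk => ?_) (fun k hk k' hk' h => ?_) (fun x hx => ?_)
  · rw [Finset.mem_filter, Finset.mem_range] at hk
    rw [Finset.mem_filter]
    refine ⟨Finset.mem_univ _, ?_⟩
    have := (ZMod.intCast_zmod_eq_zero_iff_dvd ((k : ℤ) ^ 2 + t * k + n) q).mpr hk.2
    push_cast at this
    exact this
  · rw [Finset.mem_filter, Finset.mem_range] at hk hk'
    have := congrArg ZMod.val h
    rwa [ZMod.val_cast_of_lt hk.1, ZMod.val_cast_of_lt hk'.1] at this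
  · rw [Finset.mem_filter] at hx
    refine ⟨x.val, ?_, ZMod.natCast_zmod_val x⟩
    rw [Finset.mem_filter, Finset.mem_range]
    refine ⟨ZMod.val_lt x, ?_⟩
    rw [← ZMod.intCast_zmod_eq_zero_iff_dvd]
    push_cast
    rw [ZMod.natCast_zmod_val]
    exact hx.2

/-- **The non-units of `𝔽_q[ω̄]`**: `#{(x, y) : x² + txy + ny² = 0} = 1 + ρ (q - 1)`
(`y = 0` forces `x = 0`; for `y ≠ 0`, `x/y` is a root). [folklore] -/
theorem card_norm_eq_zero (t n : ℤ) :
    ((Finset.univ : Finset (ZMod q × ZMod q)).filter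
        (fun xy => xy.1 ^ 2 + (t : ZMod q) * xy.1 * xy.2 + (n : ZMod q) * xy.2 ^ 2 = 0)).card =
      1 + ((Finset.univ : Finset (ZMod q)).filter
        (fun k => k ^ 2 + (t : ZMod q) * k + (n : ZMod q) = 0)).card * (q - 1) := by
  classical
  set N : ZMod q × ZMod q → ZMod q := fun xy => xy.1 ^ 2 + (t : ZMod q) * xy.1 * xy.2 + (n : ZMod q) * xy.2 ^ 2
    with hN
  set R := (Finset.univ : Finset (ZMod q)).filter (fun k => k ^ 2 + (t : ZMod q) * k + (n : ZMod q) = 0)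
    with hR
  have hsplit : (Finset.univ.filter fun xy => N xy = 0) =
      (Finset.univ.filter fun xy : ZMod q × ZMod q => N xy = 0 ∧ xy.2 = 0) ∪
        (Finset.univ.filter fun xy : ZMod q × ZMod q => N xy = 0 ∧ xy.2 ≠ 0) := by
    rw [← Finset.filter_or]
    refine Finset.filter_congr fun xy _ => ?_
    tauto
  have hdisj : Disjoint (Finset.univ.filter fun xy : ZMod q × ZMod q => N xy = 0 ∧ xy.2 = 0)
      (Finset.univ.filter fun xy : ZMod q × ZMod q => N xy = 0 ∧ xy.2 ≠ 0) :=
    Finset.disjoint_filter.mpr fun xy _ h h' => h'.2 h.2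
  -- `y = 0`: only `(0, 0)`
  have h0 : (Finset.univ.filter fun xy : ZMod q × ZMod q => N xy = 0 ∧ xy.2 = 0) = {(0, 0)} := by
    ext ⟨x, y⟩
    simp only [Finset.mem_filter, Finset.mem_univ, true_and, Finset.mem_singleton, Prod.mk.injEq, hN]
    constructor
    · rintro ⟨h, rfl⟩
      simp only [mul_zero, zero_pow two_ne_zero, add_zero] at h
      exact ⟨pow_eq_zero_iff two_ne_zero |>.mp h, rfl⟩
    · rintro ⟨rfl, rfl⟩
      simp
  -- `y ≠ 0`: `(x, y) ↦ (x/y, y)` onto `R × 𝔽_qˣ`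
  have h1 : (Finset.univ.filter fun xy : ZMod q × ZMod q => N xy = 0 ∧ xy.2 ≠ 0).card =
      (R ×ˢ (Finset.univ.filter fun y : ZMod q => y ≠ 0)).card := by
    refine Finset.card_bij (fun xy _ => (xy.1 * xy.2⁻¹, xy.2)) (fun xy hxy => ?_) (fun xy hxy xy' hxy' h => ?_)
      (fun ky hky => ?_)
    · rw [Finset.mem_filter] at hxy
      obtain ⟨-, hNxy, hy⟩ := hxy
      rw [Finset.mem_product, hR, Finset.mem_filter, Finset.mem_filter]
      refine ⟨⟨Finset.mem_univ _, ?_⟩, Finset.mem_univ _, hy⟩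
      have e : (xy.1 * xy.2⁻¹) ^ 2 + (t : ZMod q) * (xy.1 * xy.2⁻¹) + (n : ZMod q) = N xy * (xy.2⁻¹) ^ 2 := by
        rw [hN]; field_simp
      rw [e, hNxy, zero_mul]
    · simp only [Prod.mk.injEq] at h
      obtain ⟨h1, h2⟩ := h
      rw [Finset.mem_filter] at hxy
      have hy : xy.2 ≠ 0 := hxy.2.2
      have : xy.1 = xy'.1 := by
        have e := congrArg (· * xy.2) h1
        have e' : xy.1 * xy.2⁻¹ * xy.2 = xy'.1 * xy'.2⁻¹ * xy.2 := e
        rwa [inv_mul_cancel_right₀ hy, h2, inv_mul_cancel_right₀ (h2 ▸ hy)] at e'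
      exact Prod.ext this h2
    · rw [Finset.mem_product, hR, Finset.mem_filter, Finset.mem_filter] at hky
      obtain ⟨⟨-, hk⟩, -, hy⟩ := hky
      refine ⟨(ky.1 * ky.2, ky.2), ?_, ?_⟩
      · rw [Finset.mem_filter]
        refine ⟨Finset.mem_univ _, ?_, hy⟩
        have e : N (ky.1 * ky.2, ky.2) = (ky.1 ^ 2 + (t : ZMod q) * ky.1 + (n : ZMod q)) * ky.2 ^ 2 := by
          rw [hN]; ring
        rw [e, hk, zero_mul]
      · simp [mul_inv_cancel_right₀ hy]
  have hunits : (Finset.univ.filter fun y : ZMod q => y ≠ 0).card = q - 1 := by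
    rw [Finset.filter_ne' Finset.univ (0 : ZMod q), Finset.card_erase_of_mem (Finset.mem_univ _),
      Finset.card_univ, ZMod.card]
  rw [hsplit, Finset.card_union_of_disjoint hdisj, h0, Finset.card_singleton, h1, Finset.card_product, hunits]

/-- **`#(𝔽_q[X]/(X² - tX + n))ˣ = (q - 1)(q + 1 - ρ)`**, `ρ` the number of roots of
`X² + tX + n` mod `q` (`q² - 1`, `q(q - 1)`, `(q - 1)²` for `ρ = 0, 1, 2`). [cite: Cox2013, Thm. 7.24 (proof, (7.27))] -/
theorem card_units_resAlg (t n : ℤ) :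
    Nat.card (ResAlg q t n)ˣ =
      (q - 1) * (q + 1 - ((Finset.range q).filter (fun k : ℕ => (q : ℤ) ∣ (k : ℤ) ^ 2 + t * k + n)).card) := by
  classical
  letI : Fintype (ResAlg q t n) := Fintype.ofEquiv _ (QuadraticAlgebra.equivProd _ _).symm
  set ρ := ((Finset.range q).filter (fun k : ℕ => (q : ℤ) ∣ (k : ℤ) ^ 2 + t * k + n)).card with hρ
  have hρq : ρ ≤ q := by
    rw [hρ]; exact (Finset.card_filter_le _ _).trans (Finset.card_range q).le
  -- units ↔ nonzero norm, counted in coordinates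
  have hunit : ∀ z : ResAlg q t n, IsUnit z ↔
      ¬ (z.re ^ 2 + (t : ZMod q) * z.re * z.im + (n : ZMod q) * z.im ^ 2 = 0) := fun z => by
    rw [QuadraticAlgebra.isUnit_iff_norm_isUnit, isUnit_iff_ne_zero, norm_resAlg]
  have hcardU : Nat.card (ResAlg q t n)ˣ =
      ((Finset.univ : Finset (ZMod q × ZMod q)).filter
        (fun xy => ¬ (xy.1 ^ 2 + (t : ZMod q) * xy.1 * xy.2 + (n : ZMod q) * xy.2 ^ 2 = 0))).card := by
    rw [Nat.card_congr ((unitsEquivIsUnitSubtype (ResAlg q t n)).trans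
      (Equiv.subtypeEquiv (p := IsUnit)
        (q := fun xy : ZMod q × ZMod q => ¬ (xy.1 ^ 2 + (t : ZMod q) * xy.1 * xy.2 + (n : ZMod q) * xy.2 ^ 2 = 0))
        (QuadraticAlgebra.equivProd _ _) (fun z => hunit z))),
      Nat.card_eq_fintype_card, Fintype.card_subtype]
  have htot : ((Finset.univ : Finset (ZMod q × ZMod q)).filter
        (fun xy => ¬ (xy.1 ^ 2 + (t : ZMod q) * xy.1 * xy.2 + (n : ZMod q) * xy.2 ^ 2 = 0))).card +
      ((Finset.univ : Finset (ZMod q × ZMod q)).filter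
        (fun xy => xy.1 ^ 2 + (t : ZMod q) * xy.1 * xy.2 + (n : ZMod q) * xy.2 ^ 2 = 0)).card = q ^ 2 := by
    rw [add_comm, Finset.card_filter_add_card_filter_not, Finset.card_univ, Fintype.card_prod,
      ZMod.card, sq]
  rw [card_norm_eq_zero, card_roots_zmod, ← hρ] at htot
  rw [hcardU]
  have hq1 : 1 ≤ q := hq.out.one_lt.le
  zify [hq1, (by omega : ρ ≤ q + 1)] at htot ⊢
  linear_combination htot

/-- **The scalar units `𝔽_qˣ ⊆ (𝔽_q[ω̄])ˣ`.** [folklore] -/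
def scalarUnits (q : ℕ) [Fact q.Prime] (t n : ℤ) : Subgroup (ResAlg q t n)ˣ where
  carrier := {x | (x : ResAlg q t n).im = 0}
  one_mem' := rfl
  mul_mem' {x y} hx hy := by
    change ((x : ResAlg q t n) * y).im = 0
    change (x : ResAlg q t n).im = 0 at hx
    change (y : ResAlg q t n).im = 0 at hy
    rw [QuadraticAlgebra.im_mul, hx, hy]
    ring
  inv_mem' {x} hx := by
    change ((x⁻¹ : (ResAlg q t n)ˣ) : ResAlg q t n).im = 0
    change (x : ResAlg q t n).im = 0 at hx
    have h1 := congrArg QuadraticAlgebra.im x.mul_inv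
    have h2 := congrArg QuadraticAlgebra.re x.mul_inv
    rw [QuadraticAlgebra.im_mul, hx] at h1
    rw [QuadraticAlgebra.re_mul, hx] at h2
    simp only [zero_mul, add_zero, mul_zero, QuadraticAlgebra.im_one, QuadraticAlgebra.re_one] at h1 h2
    have hre : (x : ResAlg q t n).re ≠ 0 := fun h => by rw [h, zero_mul] at h2; exact zero_ne_one h2
    exact (mul_eq_zero.mp h1).resolve_left hre

/-- Membership in `scalarUnits` (definitional). [folklore] -/
theorem mem_scalarUnits_iff {t n : ℤ} {x : (ResAlg q t n)ˣ} : x ∈ scalarUnits q t n ↔ (x : ResAlg q t n).im = 0 :=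
  Iff.rfl

/-- A scalar unit has nonzero real part. [folklore] -/
theorem re_ne_zero_of_mem_scalarUnits {t n : ℤ} {x : (ResAlg q t n)ˣ} (hx : x ∈ scalarUnits q t n) :
    (x : ResAlg q t n).re ≠ 0 := by
  intro h
  have h2 := congrArg QuadraticAlgebra.re x.mul_inv
  rw [QuadraticAlgebra.re_mul, mem_scalarUnits_iff.mp hx, h] at h2
  simp [QuadraticAlgebra.re_one] at h2

/-- **`#𝔽_qˣ = q - 1`** scalar units. [folklore] -/
theorem card_scalarUnits (t n : ℤ) : Nat.card (scalarUnits q t n) = q - 1 := by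
  classical
  have e : scalarUnits q t n ≃ (ZMod q)ˣ :=
    { toFun := fun x => Units.mk0 ((x : (ResAlg q t n)ˣ) : ResAlg q t n).re (re_ne_zero_of_mem_scalarUnits x.2)
      invFun := fun c => ⟨⟨⟨(c : ZMod q), 0⟩, ⟨((c⁻¹ : (ZMod q)ˣ) : ZMod q), 0⟩,
          by ext <;> simp only [QuadraticAlgebra.re_mul, QuadraticAlgebra.im_mul, QuadraticAlgebra.re_one,
            QuadraticAlgebra.im_one, mul_zero, zero_mul, add_zero, Units.mul_inv],
          by ext <;> simp only [QuadraticAlgebra.re_mul, QuadraticAlgebra.im_mul, QuadraticAlgebra.re_one,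
            QuadraticAlgebra.im_one, mul_zero, zero_mul, add_zero, Units.inv_mul]⟩, rfl⟩
      left_inv := fun x => Subtype.ext (Units.ext (QuadraticAlgebra.ext rfl (mem_scalarUnits_iff.mp x.2).symm))
      right_inv := fun c => Units.ext rfl }
  rw [Nat.card_congr e, Nat.card_eq_fintype_card, ZMod.card_units]

end Count

/-! ### The setting: `B = ℤ[pσ] ⊆ B' = ℤ[σ]` inside `ℚ(γ) ⊆ D` -/

section Step

variable {D : Type u} [Ring D] [Algebra ℚ D] [IsQuaternionAlgebra ℚ D] {p : ℕ} [hp : Fact p.Prime]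
  {γ : D} {B B' : Submodule ℤ D} {σ : D} {r₀ : ℚ} {m : ℕ} {t n : ℤ}

/-- The quadratic `ℚ_p`-algebra `K_p = ℚ_p[X]/(X² - trd(γ) X + nrd(γ))` of `γ` (notation). -/
local notation "Kp" D ";" p ";" γ =>
  QuadraticAlgebra ℚ_[p] (-((reducedNorm ℚ D γ : ℚ) : ℚ_[p])) ((reducedTrace ℚ D γ : ℚ) : ℚ_[p])

/-- The generator `σ_p = r₀ + ω/m` of `B'_p = [1, σ_p]` (notation). -/
local notation "σq" => (QuadraticAlgebra.mk (r₀ : ℚ_[p]) (((m : ℚ)⁻¹ : ℚ) : ℚ_[p]) : Kp D ; p ; γ)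

/-- `(r + sγ)(r' + s'γ)` in coordinates (`γ² = trd(γ) γ - nrd(γ)`). [folklore] -/
theorem ratCoords_mul (γ : D) (r s r' s' : ℚ) :
    (algebraMap ℚ D r + s • γ) * (algebraMap ℚ D r' + s' • γ) =
      algebraMap ℚ D (r * r' - s * s' * reducedNorm ℚ D γ) +
        (r * s' + s * r' + s * s' * reducedTrace ℚ D γ) • γ := by
  have hγ2 : γ * γ = (reducedTrace ℚ D γ) • γ - (reducedNorm ℚ D γ) • (1 : D) := by
    rw [mul_self_eq_reducedTrace_mul_sub_reducedNorm ℚ D γ, ← Algebra.smul_def, Algebra.algebraMap_eq_smul_one]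
  simp only [Algebra.algebraMap_eq_smul_one, add_mul, mul_add, smul_mul_smul_comm, one_mul, mul_one, hγ2,
    smul_sub, smul_smul]
  module

open Classical in
/-- **The coordinate map `ℚ(γ) → K_p`**, `r + sγ ↦ r + sω` (junk `0` off `ℚ(γ)`). [folklore] -/
def zK (p : ℕ) [Fact p.Prime] (hD : ∀ x : D, x ≠ 0 → IsUnit x) (hγ : γ ∉ (⊥ : Subalgebra ℚ D)) (u : D) :
    Kp D ; p ; γ :=
  if hu : u ∈ Algebra.adjoin ℚ {γ} then
    ⟨((exists_rat_eq_of_mem_adjoin hD hγ hu).choose : ℚ_[p]),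
      ((exists_rat_eq_of_mem_adjoin hD hγ hu).choose_spec.choose : ℚ_[p])⟩
  else 0

/-- `zK (r + sγ) = r + sω`. [folklore] -/
theorem zK_ratCoords (hD : ∀ x : D, x ≠ 0 → IsUnit x) (hγ : γ ∉ (⊥ : Subalgebra ℚ D)) (r s : ℚ) :
    zK p hD hγ (algebraMap ℚ D r + s • γ) = ⟨(r : ℚ_[p]), (s : ℚ_[p])⟩ := by
  classical
  have hu : algebraMap ℚ D r + s • γ ∈ Algebra.adjoin ℚ {γ} := ratCoords_mem_adjoin γ r s
  rw [zK, dif_pos hu]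
  have e := (exists_rat_eq_of_mem_adjoin hD hγ hu).choose_spec.choose_spec
  obtain ⟨h1, h2⟩ := rat_coords_unique hγ e
  ext
  · exact congrArg (fun x : ℚ => (x : ℚ_[p])) h1.symm
  · exact congrArg (fun x : ℚ => (x : ℚ_[p])) h2.symm

/-- `zK 1 = 1`. [folklore] -/
theorem zK_one (hD : ∀ x : D, x ≠ 0 → IsUnit x) (hγ : γ ∉ (⊥ : Subalgebra ℚ D)) :
    zK p hD hγ (1 : D) = 1 := by
  have : (1 : D) = algebraMap ℚ D 1 + (0 : ℚ) • γ := by rw [map_one, zero_smul, add_zero]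
  rw [this, zK_ratCoords]
  ext <;> simp [QuadraticAlgebra.re_one, QuadraticAlgebra.im_one]

/-- `zK 0 = 0`. [folklore] -/
theorem zK_zero (hD : ∀ x : D, x ≠ 0 → IsUnit x) (hγ : γ ∉ (⊥ : Subalgebra ℚ D)) :
    zK p hD hγ (0 : D) = 0 := by
  have : (0 : D) = algebraMap ℚ D 0 + (0 : ℚ) • γ := by rw [map_zero, zero_smul, add_zero]
  rw [this, zK_ratCoords]
  ext <;> simp

/-- **`zK` is multiplicative on `ℚ(γ)`.** [folklore] -/
theorem zK_mul (hD : ∀ x : D, x ≠ 0 → IsUnit x) (hγ : γ ∉ (⊥ : Subalgebra ℚ D)) {u v : D}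
    (hu : u ∈ Algebra.adjoin ℚ {γ}) (hv : v ∈ Algebra.adjoin ℚ {γ}) :
    zK p hD hγ (u * v) = zK p hD hγ u * zK p hD hγ v := by
  obtain ⟨r, s, rfl⟩ := exists_rat_eq_of_mem_adjoin hD hγ hu
  obtain ⟨r', s', rfl⟩ := exists_rat_eq_of_mem_adjoin hD hγ hv
  rw [ratCoords_mul, zK_ratCoords, zK_ratCoords, zK_ratCoords]
  ext
  · simp only [QuadraticAlgebra.re_mul]; push_cast; ring
  · simp only [QuadraticAlgebra.im_mul]; push_cast; ring

/-- An element commuting with `γ ∉ ℚ` lies in `ℚ(γ)` (double centraliser). [cite: VignerasLNM800, Ch. I §1] -/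
theorem mem_adjoin_of_comm (hD : ∀ x : D, x ≠ 0 → IsUnit x) (hγ : γ ∉ (⊥ : Subalgebra ℚ D)) {u : D}
    (hu : u * γ = γ * u) : u ∈ Algebra.adjoin ℚ {γ} := by
  rw [← Subalgebra.centralizer_singleton_eq_adjoin hD (IsQuaternionAlgebra.finrank_eq_four (K := ℚ)) hγ,
    Subalgebra.mem_centralizer_iff]
  intro g hg
  rw [Set.mem_singleton_iff] at hg
  rw [hg, hu]

/-- **The rational points of `[1, r₁ + s₁ω]` are `B_(p)`** for an order `B = ℤ[σ₀]`,
`σ₀ = r₁ + s₁γ`: `r + sω ∈ [1, r₁ + s₁ω] ↔ r + sγ ∈ B_(p)`. [folklore] -/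
theorem ratCoords_mem_latt_one_iff_gen (hγ : γ ∉ (⊥ : Subalgebra ℚ D)) {B : Submodule ℤ D} {σ₀ : D}
    {r₁ s₁ : ℚ} (hs₁ : s₁ ≠ 0) (hσ₀ : σ₀ = algebraMap ℚ D r₁ + s₁ • γ)
    (hBσ : ∀ b : D, b ∈ B ↔ ∃ u v : ℤ, b = algebraMap ℚ D u + v • σ₀) (r s : ℚ) :
    (⟨(r : ℚ_[p]), (s : ℚ_[p])⟩ : Kp D ; p ; γ) ∈
        latt 1 (⟨(r₁ : ℚ_[p]), (s₁ : ℚ_[p])⟩ : Kp D ; p ; γ) ↔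
      algebraMap ℚ D r + s • γ ∈ localAt p B := by
  have hcop : ∀ w : ℚ, w.den.Coprime p ↔ ‖(w : ℚ_[p])‖ ≤ 1 := fun w => by
    rw [Padic.norm_ratCast_le_one_iff, Nat.coprime_comm, Nat.Prime.coprime_iff_not_dvd hp.out]
  have hs₁q : (s₁ : ℚ_[p]) ≠ 0 := by exact_mod_cast hs₁
  have eσ : ∀ u v : ℚ, algebraMap ℚ D u + v • σ₀ = algebraMap ℚ D (u + v * r₁) + (v * s₁) • γ := by
    intro u v
    rw [hσ₀, smul_add, smul_smul, map_add, Algebra.algebraMap_eq_smul_one, Algebra.algebraMap_eq_smul_one,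
      Algebra.algebraMap_eq_smul_one]
    module
  rw [IsQuadOrder.mem_localAt_iff_of_monogenic hBσ]
  constructor
  · rintro ⟨u, w, hu, hw, huw⟩
    have hre := congrArg QuadraticAlgebra.re huw
    have him := congrArg QuadraticAlgebra.im huw
    simp only [QuadraticAlgebra.re_add, QuadraticAlgebra.im_add, QuadraticAlgebra.re_smul,
      QuadraticAlgebra.im_smul, smul_eq_mul] at hre him
    change (r : ℚ_[p]) = u * 1 + w * r₁ at hre
    change (s : ℚ_[p]) = u * 0 + w * s₁ at him
    have hw' : w = ((s / s₁ : ℚ) : ℚ_[p]) := by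
      push_cast; rw [him]; field_simp; ring
    have hu' : u = ((r - s / s₁ * r₁ : ℚ) : ℚ_[p]) := by
      push_cast; rw [hre, hw']; push_cast; ring
    refine ⟨r - s / s₁ * r₁, s / s₁, ?_, ?_, ?_⟩
    · rw [hcop, ← hu']; exact hu
    · rw [hcop, ← hw']; exact hw
    · rw [eσ]
      congr 2
      · ring
      · field_simp
  · rintro ⟨u, v, hu, hv, huv⟩
    obtain ⟨h1, h2⟩ := rat_coords_unique hγ (huv.trans (eσ u v))
    refine ⟨u, v, (hcop u).mp hu, (hcop v).mp hv, ?_⟩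
    ext
    · simp only [QuadraticAlgebra.re_add, QuadraticAlgebra.re_smul, QuadraticAlgebra.re_one, smul_eq_mul,
        mul_one, h1]
      push_cast; rfl
    · simp only [QuadraticAlgebra.im_add, QuadraticAlgebra.im_smul, QuadraticAlgebra.im_one, smul_eq_mul,
        mul_zero, zero_add, h2]
      push_cast; rfl

/-- **Hypotheses of the one-step unit index**, bundled: `D` is a division algebra, `γ ∉ ℚ`,
`B ⊆ B'` are orders of `ℚ(γ)` through `γ` with `ℤ`-bases `(1, pσ)` and `(1, σ)`, `σ = r₀ + γ/m`,
`σ² = tσ - n`. [cite: Cox2013, Thm. 7.24 (proof)] -/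
structure StepHyp (p : ℕ) [Fact p.Prime] (γ : D) (B B' : Submodule ℤ D) (σ : D) (r₀ : ℚ) (m : ℕ)
    (t n : ℤ) : Prop where
  hdiv : ∀ x : D, x ≠ 0 → IsUnit x
  hγ : γ ∉ (⊥ : Subalgebra ℚ D)
  hB : IsQuadOrder γ B
  hB' : IsQuadOrder γ B'
  hm : m ≠ 0
  hσ : σ = algebraMap ℚ D r₀ + (m : ℚ)⁻¹ • γ
  hBσ' : ∀ b : D, b ∈ B' ↔ ∃ u v : ℤ, b = algebraMap ℚ D u + v • σ
  hBσ : ∀ b : D, b ∈ B ↔ ∃ u v : ℤ, b = algebraMap ℚ D u + v • ((p : ℚ) • σ)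
  hsq : σ * σ = (t : ℚ) • σ - algebraMap ℚ D n

namespace StepHyp

variable (H : StepHyp p γ B B' σ r₀ m t n)
include H

omit [IsQuaternionAlgebra ℚ D] in
/-- `σ_p ∉ ℚ_p`. [folklore] -/
theorem σq_im_ne : (σq).im ≠ 0 := by
  show (((m : ℚ)⁻¹ : ℚ) : ℚ_[p]) ≠ 0
  push_cast
  exact inv_ne_zero (Nat.cast_ne_zero.mpr H.hm)

/-- **`trd σ = t` and `nrd σ = n`.** [folklore] -/
theorem reducedTrace_σ_and_reducedNorm_σ : reducedTrace ℚ D σ = t ∧ reducedNorm ℚ D σ = n := by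
  have hmQ : (m : ℚ) ≠ 0 := Nat.cast_ne_zero.mpr H.hm
  have e : ∀ c d : ℚ, c • σ - algebraMap ℚ D d =
      algebraMap ℚ D (c * r₀ - d) + (c * (m : ℚ)⁻¹) • γ := by
    intro c d
    rw [H.hσ, smul_add, smul_smul, map_sub, map_mul, Algebra.smul_def c (algebraMap ℚ D r₀)]
    abel
  have h1 := mul_self_eq_reducedTrace_mul_sub_reducedNorm ℚ D σ
  rw [H.hsq, ← Algebra.smul_def, e, e] at h1
  obtain ⟨h2, h3⟩ := rat_coords_unique H.hγ h1
  have ht : reducedTrace ℚ D σ = t := by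
    have := mul_right_cancel₀ (inv_ne_zero hmQ) h3
    exact this.symm
  refine ⟨ht, ?_⟩
  rw [ht] at h2
  linarith

/-- `tr σ_p = t`. [folklore] -/
theorem tr_σq : tr σq = (t : ℚ_[p]) := by
  rw [← ratCast_reducedTrace_ratCoords, ← H.hσ, H.reducedTrace_σ_and_reducedNorm_σ.1]
  push_cast
  rfl

/-- `N σ_p = n`. [folklore] -/
theorem norm_σq : (σq).norm = (n : ℚ_[p]) := by
  rw [← ratCast_reducedNorm_ratCoords, ← H.hσ, H.reducedTrace_σ_and_reducedNorm_σ.2]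
  push_cast
  rfl

/-- `[1, σ_p]` is its own multiplier ring (a ring lattice: `tr σ_p = t`, `N σ_p = n` are integral). [folklore] -/
theorem mult_eq_latt : mult 1 σq = latt 1 σq := by
  apply mult_one_eq_latt
  rw [mul_self_mem_latt_one_iff H.σq_im_ne, H.tr_σq, H.norm_σq]
  exact ⟨Padic.norm_int_le_one _, Padic.norm_int_le_one _⟩

/-- `[1, σ_p]` is closed under multiplication. [folklore] -/
theorem mul_mem_latt {z w : Kp D ; p ; γ} (hz : z ∈ latt 1 σq) (hw : w ∈ latt 1 σq) : z * w ∈ latt 1 σq := by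
  have hz' : z ∈ mult 1 σq := by rw [H.mult_eq_latt]; exact hz
  exact mem_mult_iff.mp hz' w hw

/-- `r + sω ∈ [1, σ_p] ↔ r + sγ ∈ B'_(p)`. [folklore] -/
theorem ratCoords_mem_latt_iff (r s : ℚ) :
    (⟨(r : ℚ_[p]), (s : ℚ_[p])⟩ : Kp D ; p ; γ) ∈ latt 1 σq ↔ algebraMap ℚ D r + s • γ ∈ localAt p B' := by
  have := ratCoords_mem_latt_one_iff_gen (p := p) H.hγ (inv_ne_zero (Nat.cast_ne_zero.mpr H.hm) :
    ((m : ℚ)⁻¹ : ℚ) ≠ 0) H.hσ H.hBσ' r s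
  exact this

/-- `r + sω ∈ [1, pσ_p] ↔ r + sγ ∈ B_(p)`. [folklore] -/
theorem ratCoords_mem_latt_smul_iff (r s : ℚ) :
    (⟨(r : ℚ_[p]), (s : ℚ_[p])⟩ : Kp D ; p ; γ) ∈ latt 1 ((p : ℚ_[p]) • σq) ↔
      algebraMap ℚ D r + s • γ ∈ localAt p B := by
  have hpσ : (p : ℚ) • σ = algebraMap ℚ D (p * r₀) + ((p : ℚ) * (m : ℚ)⁻¹) • γ := by
    rw [H.hσ, smul_add, smul_smul, map_mul, Algebra.smul_def (p : ℚ) (algebraMap ℚ D r₀)]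
  have hs₁ : (p : ℚ) * (m : ℚ)⁻¹ ≠ 0 :=
    mul_ne_zero (Nat.cast_ne_zero.mpr hp.out.ne_zero) (inv_ne_zero (Nat.cast_ne_zero.mpr H.hm))
  have := ratCoords_mem_latt_one_iff_gen (p := p) H.hγ hs₁ hpσ H.hBσ r s
  rw [← this]
  congr! 2

/-! ### Units of the localised orders -/

omit [IsQuaternionAlgebra ℚ D] in
/-- `u ∈ B'_(p)ˣ ↔ u, u⁻¹ ∈ B'_(p)` and `uγ = γu`. [folklore] -/
theorem mem_stab'_iff (u : Dˣ) : u ∈ stabCentralizer (localAt p B') γ ↔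
    (u : D) ∈ localAt p B' ∧ ((u⁻¹ : Dˣ) : D) ∈ localAt p B' ∧ (u : D) * γ = γ * u := by
  rw [mem_stabCentralizer_iff, ← MulAction.mem_stabilizer_iff, mem_stabilizer_iff_mem_leftOrder,
    IsQuadOrder.leftOrder_localAt_eq H.hB'.one_mem H.hB'.mul_mem, and_assoc]

omit [IsQuaternionAlgebra ℚ D] in
/-- `u ∈ B_(p)ˣ ↔ u, u⁻¹ ∈ B_(p)` and `uγ = γu`. [folklore] -/
theorem mem_stab_iff (u : Dˣ) : u ∈ stabCentralizer (localAt p B) γ ↔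
    (u : D) ∈ localAt p B ∧ ((u⁻¹ : Dˣ) : D) ∈ localAt p B ∧ (u : D) * γ = γ * u := by
  rw [mem_stabCentralizer_iff, ← MulAction.mem_stabilizer_iff, mem_stabilizer_iff_mem_leftOrder,
    IsQuadOrder.leftOrder_localAt_eq H.hB.one_mem H.hB.mul_mem, and_assoc]

/-- `u ∈ B'_(p) ↔ zK u ∈ [1, σ_p]` for `u ∈ ℚ(γ)`. [folklore] -/
theorem mem_localAt_iff_zK {u : D} (hu : u ∈ Algebra.adjoin ℚ {γ}) :
    u ∈ localAt p B' ↔ zK p H.hdiv H.hγ u ∈ latt 1 σq := by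
  obtain ⟨r, s, rfl⟩ := exists_rat_eq_of_mem_adjoin H.hdiv H.hγ hu
  rw [zK_ratCoords, H.ratCoords_mem_latt_iff]

/-- `u ∈ B_(p) ↔ zK u ∈ [1, pσ_p]` for `u ∈ ℚ(γ)`. [folklore] -/
theorem mem_localAt_iff_zK_smul {u : D} (hu : u ∈ Algebra.adjoin ℚ {γ}) :
    u ∈ localAt p B ↔ zK p H.hdiv H.hγ u ∈ latt 1 ((p : ℚ_[p]) • σq) := by
  obtain ⟨r, s, rfl⟩ := exists_rat_eq_of_mem_adjoin H.hdiv H.hγ hu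
  rw [zK_ratCoords, H.ratCoords_mem_latt_smul_iff]

omit [IsQuaternionAlgebra ℚ D] in
/-- **`[1, pσ_p] = {z ∈ [1, σ_p] : y(z) ∈ pℤ_p}`.** [folklore] -/
theorem mem_latt_smul_iff {z : Kp D ; p ; γ} (hz : z ∈ latt 1 σq) :
    z ∈ latt 1 ((p : ℚ_[p]) • σq) ↔ ‖yCo σq z‖ < 1 := by
  have hσ := H.σq_im_ne
  constructor
  · rintro ⟨u', v', -, hv', h⟩
    rw [smul_smul] at h
    obtain ⟨-, h2⟩ := xCo_yCo_of_eq hσ h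
    rw [h2, norm_mul, Padic.norm_p]
    have hp1 : (1 : ℝ) < p := by exact_mod_cast hp.out.one_lt
    calc ‖v'‖ * (p : ℝ)⁻¹ ≤ 1 * (p : ℝ)⁻¹ := by gcongr
      _ < 1 := by rw [one_mul]; exact inv_lt_one_of_one_lt₀ hp1
  · intro h
    rw [norm_lt_one_iff_exists] at h
    obtain ⟨c, hc, e⟩ := h
    refine ⟨xCo σq z, c, (norm_xCo_le_of_mem hσ hz).1, hc, ?_⟩
    conv_lhs => rw [eq_xCo_add_yCo hσ z, e]
    rw [smul_smul, mul_comm]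

/-- `zK u ∈ [1, σ_p]` for `u ∈ B'_(p)ˣ`. [folklore] -/
theorem zK_mem_latt {u : Dˣ} (hu : u ∈ stabCentralizer (localAt p B') γ) :
    zK p H.hdiv H.hγ (u : D) ∈ latt 1 σq :=
  have h := (H.mem_stab'_iff u).mp hu
  (H.mem_localAt_iff_zK (mem_adjoin_of_comm H.hdiv H.hγ h.2.2)).mp h.1

/-- `zK u⁻¹ ∈ [1, σ_p]` for `u ∈ B'_(p)ˣ`. [folklore] -/
theorem zK_inv_mem_latt {u : Dˣ} (hu : u ∈ stabCentralizer (localAt p B') γ) :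
    zK p H.hdiv H.hγ ((u⁻¹ : Dˣ) : D) ∈ latt 1 σq :=
  have h := (H.mem_stab'_iff u).mp hu
  (H.mem_localAt_iff_zK (mem_adjoin_of_comm H.hdiv H.hγ (units_inv_comm h.2.2))).mp h.2.1

/-- `Θ(zK u) Θ(zK u⁻¹) = 1`. [folklore] -/
theorem theta_zK_mul_inv {u : Dˣ} (hu : u ∈ stabCentralizer (localAt p B') γ) :
    theta σq t n (zK p H.hdiv H.hγ (u : D)) * theta σq t n (zK p H.hdiv H.hγ ((u⁻¹ : Dˣ) : D)) = 1 := by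
  have h := (H.mem_stab'_iff u).mp hu
  rw [← theta_mul H.σq_im_ne H.tr_σq H.norm_σq (H.zK_mem_latt hu) (H.zK_inv_mem_latt hu),
    ← zK_mul H.hdiv H.hγ (mem_adjoin_of_comm H.hdiv H.hγ h.2.2)
      (mem_adjoin_of_comm H.hdiv H.hγ (units_inv_comm h.2.2)),
    Units.mul_inv, zK_one, theta_one H.σq_im_ne]

/-- `Θ(zK u⁻¹) Θ(zK u) = 1`. [folklore] -/
theorem theta_zK_inv_mul {u : Dˣ} (hu : u ∈ stabCentralizer (localAt p B') γ) :
    theta σq t n (zK p H.hdiv H.hγ ((u⁻¹ : Dˣ) : D)) * theta σq t n (zK p H.hdiv H.hγ (u : D)) = 1 := by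
  rw [mul_comm, H.theta_zK_mul_inv hu]

/-- **The reduction homomorphism `Ψ : B'_(p)ˣ → (𝔽_p[ω̄])ˣ`**, `x + yσ ↦ x̄ + ȳω̄`. [cite: Cox2013, Thm. 7.24 (proof, (7.27))] -/
def Psi : stabCentralizer (localAt p B') γ →* (ResAlg p t n)ˣ where
  toFun u := ⟨theta σq t n (zK p H.hdiv H.hγ ((u : Dˣ) : D)),
    theta σq t n (zK p H.hdiv H.hγ (((u : Dˣ)⁻¹ : Dˣ) : D)), H.theta_zK_mul_inv u.2, H.theta_zK_inv_mul u.2⟩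
  map_one' := Units.ext (by
    change theta σq t n (zK p H.hdiv H.hγ (((1 : stabCentralizer (localAt p B') γ) : Dˣ) : D)) = 1
    rw [OneMemClass.coe_one, Units.val_one, zK_one, theta_one H.σq_im_ne])
  map_mul' u v := Units.ext (by
    change theta σq t n (zK p H.hdiv H.hγ (((u * v : stabCentralizer (localAt p B') γ) : Dˣ) : D)) =
      theta σq t n (zK p H.hdiv H.hγ ((u : Dˣ) : D)) * theta σq t n (zK p H.hdiv H.hγ ((v : Dˣ) : D))
    rw [Subgroup.coe_mul, Units.val_mul,
      zK_mul H.hdiv H.hγ (mem_adjoin_of_comm H.hdiv H.hγ ((H.mem_stab'_iff _).mp u.2).2.2)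
        (mem_adjoin_of_comm H.hdiv H.hγ ((H.mem_stab'_iff _).mp v.2).2.2),
      theta_mul H.σq_im_ne H.tr_σq H.norm_σq (H.zK_mem_latt u.2) (H.zK_mem_latt v.2)])

/-- The value of `Ψ`. [folklore] -/
theorem Psi_val (u : stabCentralizer (localAt p B') γ) :
    ((H.Psi u : (ResAlg p t n)ˣ) : ResAlg p t n) = theta σq t n (zK p H.hdiv H.hγ ((u : Dˣ) : D)) := rfl

/-- **`Ψ u` is a scalar iff `u ∈ B_(p)`.** [folklore] -/
theorem Psi_mem_scalarUnits_iff (u : stabCentralizer (localAt p B') γ) :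
    H.Psi u ∈ scalarUnits p t n ↔ ((u : Dˣ) : D) ∈ localAt p B := by
  have hadj := mem_adjoin_of_comm H.hdiv H.hγ ((H.mem_stab'_iff _).mp u.2).2.2
  rw [mem_scalarUnits_iff, Psi_val, theta_im_eq_zero_iff H.σq_im_ne (H.zK_mem_latt u.2),
    ← H.mem_latt_smul_iff (H.zK_mem_latt u.2), ← H.mem_localAt_iff_zK_smul hadj]

/-- **`ker(Ψ mod scalars) = B_(p)ˣ`.** [cite: Cox2013, Thm. 7.24 (proof, (7.27))] -/
theorem comap_scalarUnits_Psi :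
    (scalarUnits p t n).comap H.Psi =
      (stabCentralizer (localAt p B) γ).subgroupOf (stabCentralizer (localAt p B') γ) := by
  ext u
  rw [Subgroup.mem_comap, Subgroup.mem_subgroupOf, H.Psi_mem_scalarUnits_iff, H.mem_stab_iff]
  constructor
  · intro h
    refine ⟨h, ?_, ((H.mem_stab'_iff _).mp u.2).2.2⟩
    have hinv : H.Psi u⁻¹ ∈ scalarUnits p t n := by
      rw [map_inv]; exact Subgroup.inv_mem _ ((H.Psi_mem_scalarUnits_iff u).mpr h)
    rw [H.Psi_mem_scalarUnits_iff] at hinv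
    exact hinv
  · exact fun h => h.1

/-- `zK (X + Yr₀ + (Y/m)γ) = X • 1 + Y • σ_p`: lifting residues to `B'`. [folklore] -/
theorem zK_lift (X Y : ℕ) :
    zK p H.hdiv H.hγ (algebraMap ℚ D ((X : ℚ) + Y * r₀) + ((Y : ℚ) * (m : ℚ)⁻¹) • γ) =
      (X : ℚ_[p]) • 1 + (Y : ℚ_[p]) • σq := by
  rw [zK_ratCoords]
  ext
  · simp only [QuadraticAlgebra.re_add, QuadraticAlgebra.re_smul, QuadraticAlgebra.re_one, smul_eq_mul, mul_one]
    push_cast; ring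
  · simp only [QuadraticAlgebra.im_add, QuadraticAlgebra.im_smul, QuadraticAlgebra.im_one, smul_eq_mul,
      mul_zero, zero_add]
    push_cast; ring

/-- `Θ` of a lift. [folklore] -/
theorem theta_lift (X Y : ℕ) :
    theta σq t n (zK p H.hdiv H.hγ (algebraMap ℚ D ((X : ℚ) + Y * r₀) + ((Y : ℚ) * (m : ℚ)⁻¹) • γ)) =
      ⟨(X : ZMod p), (Y : ZMod p)⟩ := by
  obtain ⟨h1, h2⟩ := xCo_yCo_of_eq H.σq_im_ne (H.zK_lift X Y)
  change (⟨red p _, red p _⟩ : ResAlg p t n) = _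
  rw [h1, h2, red_natCast, red_natCast]

/-- A lift lies in `[1, σ_p]`. [folklore] -/
theorem zK_lift_mem (X Y : ℕ) :
    zK p H.hdiv H.hγ (algebraMap ℚ D ((X : ℚ) + Y * r₀) + ((Y : ℚ) * (m : ℚ)⁻¹) • γ) ∈ latt 1 σq := by
  rw [H.zK_lift]
  exact ⟨_, _, by simpa using Padic.norm_int_le_one (p := p) X, by simpa using Padic.norm_int_le_one (p := p) Y, rfl⟩

/-- **`Ψ` is surjective**: lift `x̄ + ȳω̄` to `u = x + yσ ∈ B'`; `u ∈ B'_(p)ˣ` because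
`zK(u) zK(v) ∈ 1 + p[1, σ_p] ⊆ [1, σ_p]ˣ` for a lift `v` of the inverse. [cite: Cox2013, Thm. 7.24 (proof, (7.27) is onto)] -/
theorem Psi_surjective : Function.Surjective H.Psi := by
  haveI : Nontrivial D := nontrivial_of_isQuaternionAlgebra
  intro c
  have hσ := H.σq_im_ne
  set X := ((c : ResAlg p t n).re).val
  set Y := ((c : ResAlg p t n).im).val
  set X' := (((c⁻¹ : (ResAlg p t n)ˣ) : ResAlg p t n).re).val
  set Y' := (((c⁻¹ : (ResAlg p t n)ˣ) : ResAlg p t n).im).val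
  set u₀ : D := algebraMap ℚ D ((X : ℚ) + Y * r₀) + ((Y : ℚ) * (m : ℚ)⁻¹) • γ with hu₀
  set v₀ : D := algebraMap ℚ D ((X' : ℚ) + Y' * r₀) + ((Y' : ℚ) * (m : ℚ)⁻¹) • γ with hv₀
  have hcu : theta σq t n (zK p H.hdiv H.hγ u₀) = c := by
    rw [H.theta_lift]; ext <;> simp [X, Y]
  have hcv : theta σq t n (zK p H.hdiv H.hγ v₀) = ((c⁻¹ : (ResAlg p t n)ˣ) : ResAlg p t n) := by
    rw [H.theta_lift]; ext <;> simp [X', Y']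
  have hzu := H.zK_lift_mem X Y
  have hzv := H.zK_lift_mem X' Y'
  rw [← hu₀] at hzu
  rw [← hv₀] at hzv
  -- `W = zK u₀ zK v₀ ≡ 1 (mod p)`, hence a unit of `[1, σ_p]`
  set W := zK p H.hdiv H.hγ u₀ * zK p H.hdiv H.hγ v₀ with hW
  have hWmem : W ∈ latt 1 σq := H.mul_mem_latt hzu hzv
  have hW1 : theta σq t n W = theta σq t n 1 := by
    rw [hW, theta_mul hσ H.tr_σq H.norm_σq hzu hzv, hcu, hcv, Units.mul_inv, theta_one hσ]
  obtain ⟨w, hw, hWw⟩ := (theta_eq_theta_iff hσ hWmem (left_mem_latt _ _)).mp hW1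
  have hW' : W = 1 + (p : ℚ_[p]) • w := by rw [← hWw]; abel
  obtain ⟨-, W', hW'mem, hWW', -⟩ :=
    exists_inverse_one_add_of_mem hσ (H.mul_mem_latt (right_mem_latt _ _) (right_mem_latt _ _)) hw
  rw [← hW'] at hWW'
  -- `u₀ ≠ 0`
  have hu0 : u₀ ≠ 0 := by
    intro h
    have : W = 0 := by rw [hW, h, zK_zero, zero_mul]
    rw [this, zero_mul] at hWW'
    exact zero_ne_one hWW'
  set U₀ : Dˣ := (H.hdiv u₀ hu0).unit with hU₀
  have hU₀val : (U₀ : D) = u₀ := (H.hdiv u₀ hu0).unit_spec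
  have hcomm : (U₀ : D) * γ = γ * U₀ := by rw [hU₀val]; exact ratCoords_comm γ _ _
  have hadj : (U₀ : D) ∈ Algebra.adjoin ℚ {γ} := mem_adjoin_of_comm H.hdiv H.hγ hcomm
  have hadj' : ((U₀⁻¹ : Dˣ) : D) ∈ Algebra.adjoin ℚ {γ} := mem_adjoin_of_comm H.hdiv H.hγ (units_inv_comm hcomm)
  -- `zK U₀⁻¹ = zK v₀ W' ∈ [1, σ_p]`
  have hinv : zK p H.hdiv H.hγ ((U₀⁻¹ : Dˣ) : D) = zK p H.hdiv H.hγ v₀ * W' := by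
    have h1 : zK p H.hdiv H.hγ ((U₀⁻¹ : Dˣ) : D) * zK p H.hdiv H.hγ u₀ = 1 := by
      rw [← hU₀val, ← zK_mul H.hdiv H.hγ hadj' hadj, Units.inv_mul, zK_one]
    have h2 : zK p H.hdiv H.hγ u₀ * (zK p H.hdiv H.hγ v₀ * W') = 1 := by rw [← mul_assoc, ← hW, hWW']
    exact left_inv_eq_right_inv h1 h2
  have hU₀mem : U₀ ∈ stabCentralizer (localAt p B') γ := by
    rw [H.mem_stab'_iff]
    refine ⟨?_, ?_, hcomm⟩
    · rw [H.mem_localAt_iff_zK hadj, hU₀val]; exact hzu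
    · rw [H.mem_localAt_iff_zK hadj', hinv]; exact H.mul_mem_latt hzv hW'mem
  refine ⟨⟨U₀, hU₀mem⟩, Units.ext ?_⟩
  rw [Psi_val]
  change theta σq t n (zK p H.hdiv H.hγ (U₀ : D)) = c
  rw [hU₀val, hcu]

/-- **The one-step local unit index**: `[ℤ_(p)[σ]ˣ : ℤ_(p)[pσ]ˣ] = p + 1 - ρ`,
`ρ = #{k mod p : p ∣ k² + tk + n}`; i.e. `p - (d/p)` if `ℤ[σ]` is maximal at `p`
(`d = t² - 4n`) and `p` otherwise. [cite: Cox2013, Thm. 7.24 (proof, (7.27)–(7.28)); VignerasLNM800, Ch. III §5 Cor. 5.12] -/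
theorem relIndex_eq :
    (stabCentralizer (localAt p B) γ).relIndex (stabCentralizer (localAt p B') γ) =
      p + 1 - ((Finset.range p).filter (fun k : ℕ => (p : ℤ) ∣ (k : ℤ) ^ 2 + t * k + n)).card := by
  have h1 : (stabCentralizer (localAt p B) γ).relIndex (stabCentralizer (localAt p B') γ) =
      (scalarUnits p t n).index := by
    rw [Subgroup.relIndex, ← H.comap_scalarUnits_Psi, Subgroup.index_comap_of_surjective _ H.Psi_surjective]
  have h2 := Subgroup.card_mul_index (scalarUnits p t n)
  rw [card_scalarUnits, card_units_resAlg] at h2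
  rw [h1]
  exact Nat.eq_of_mul_eq_mul_left (Nat.sub_pos_of_lt hp.out.one_lt) h2

end StepHyp

end Step

end Brandt

end Literature.NumberTheory.Automorphic

end
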